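import Literature.MathematicalPhysics.QuantumFieldTheory.Balaban1983to89.B12AverageCorridor267

/-!
# `T4Continuum.ShellMeasureAverageDerivative` — row S48: «DQ̃(0) = LQ̃ ON EVERY DIRECTION, `LQ̃` IS LINEAR, AND
# p. 267's `h` IS A RIGHT INVERSE OF THE FRÉCHET DERIVATIVE» — GENERIC PART (any chart `ext` of the fine fields near a
# coarse bond through a normed space, any Fréchet derivative of the chart average at `0`)
(cell `pub-balaban`, sub-cell `t4`, spine estimate NE7c (node U5b); NE7c ROUND-2 crew `t4-ne7c-formalise-*`, seat
`b2b-balaban-t4-ne7c-formalise-leaf-03` (gen 3); row S48 of `t4/b2b-balaban-t4-ne7c-p1/LEAVES-NE7c-P1.md` v2.0 (WALL §3 W-d,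
ANALYTIC HALF for the PRINTED average [B12] (2.4) ∕ [B7] (15)); ADDITIVE — imports `B12AverageCorridor267` (Literature,
p192457 ∕ v1.1) ONLY, modifies nothing; 0 sorry, 0 cite beyond equation LOCATORS; the instantiation on the owner's
S49 chart average `QtLoc` is a separate short file once S49's module is in the tree)

HONEST FRAMING.  Finite four-torus programme, rung (B)+1 only — NOT infinite volume, NOT a mass gap, NOT the Clay
problem, NOT summit progress; (B), `BetaPertHyp`, (B^μ) are not consumed.  NE7c (`T4IndicatorShell.ShellWeightBound`)
is NOT PRINTED and NOT PROVED; «NE7c ⇐ the named binders» (trigger c3); NOTHING in the countdown moves.  This file is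
CALCULUS about the PRINTED formula (2.4)∕(15) as typed in `B12AverageCorridor267` (`Qtilde`, `LQ`, `bcoef`, `hGen`,
`h_paragraph_p267_genuine`): no estimate of Bałaban's is asserted or used; no `def … : Prop` (c2); the ANALYTICITY of
the chart average (row S49, owner) is NOT proved here — it enters as the binder `HasFDerivAt Φ A 0`.  HONEST DEPENDENCY
(cell, verbatim): continuum YM on T⁴ ⇐ BetaPertH ∧ nine spine estimates (0/9 proved); BetaPertH ⇐ (D1) ∧ (D4) ∧
CAP+tail; G-an2-4 gates asym, D1 and NE2/3/4.

THE POINT.  `B12AverageCorridor267` types print's «LQ̃» (p. 267: «LQ̃B′ + C̃(B′)», the linear part of `Q̃`) as the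
DIRECTIONAL derivative `LQ L 𝒯 V B′ c := deriv (s ↦ Q̃_V(s•B′)(c)) 0` and records (its typing (c)) «Fréchet
differentiability of (2.4) in `B′` and additivity of `LQ̃` are NOT proved; the derivative is COMPUTED only along the
corridor directions».  Row S49 (owner) proves the chart average `B ↦ Q̃_V(ext B)(c)` ANALYTIC at `0` on the finite-
dimensional space of fine fields near `c`.  THIS FILE is the junction, GENERIC in the chart: for ANY normed `ℂ`-space
`E`, ANY `ℂ`-homogeneous `ext : E → (bonds → 𝔸)` (plain function + `hext`; no bundled map, so that no instance
path enters the statements) and ANY Fréchet derivative `A` of a map `Φ` with `Φ v = Q̃_V(ext v)(c)` at `0`: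
* §1 `hasDerivAt_line_of_hasFDerivAt` ∕ `deriv_line_eq` — the line derivative of a Fréchet-differentiable map IS the
  Fréchet derivative on the direction ([folklore] chain rule).
* §2 **`LQ_ext_eq`**: `LQ L 𝒯 V (ext v) c = A v` for EVERY direction `v` — the `deriv`-typed «LQ̃» IS `DQ̃(0)`;
  with a RESTRICTION `res : (bonds → 𝔸) → E` (plain function; additive ∕ `ℂ`-homogeneous where needed) such that
  `ext (res B′)` agrees with `B′` on `qppBonds L c` (locality `Qtilde_congr` ∕ `isQppLocal_LQ` BY NAME):
  **`LQ_eq_apply_res`** `LQ L 𝒯 V B′ c = A (res B′)` for EVERY configuration `B′`, hence **`LQ_add`**, **`LQ_smul`**,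
  `LQ_neg`, `LQ_sub` — «LQ̃» IS ADDITIVE AND `ℂ`-HOMOGENEOUS at `c` (typing (c) of that module CLOSED, conditionally on
  the derivative binder S49 supplies).
* §3 THE CORRIDOR COEFFICIENT: `bcoef L (LQ L 𝒯 V) c X = A (res (δ_{b₀(c)} X))` (`bcoef_LQ_eq_apply_res`), and under
  the loop small field `‖W_x(V) − 1‖ < 1` off-axis `A (res (δ_{b₀(c)} X)) = bcoefVal L 𝒯 V c X` — the CLOSED FORM of
  `hasDerivAt_Qtilde_single` ∕ `bcoef_LQ` is the Fréchet derivative on the corridor direction.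
* §4 p. 267's `h` AND THE FRÉCHET DERIVATIVE: under the hypotheses of `h_paragraph_p267_genuine` (block-local,
  axis-straight `𝒯`; `‖W_x(V) − 1‖ ≤ ε ≤ 1/8` off-axis; `‖V b‖, ‖(V b)⁻¹‖ ≤ 1`; `(Lᵈ/L)·24ε < 1`):
  **`apply_res_hOp_eq`** `A (res (h B)) = B c` for the corridor-supported `h = hOp b₀ hGen` and EVERY coarse field `B`
  («LQ̃h = I» read through `DQ̃(0)`); **`apply_res_single_hGen`** `A (res (δ_{b₀(c)} (hGen c X))) = X`;
  **`hGen_smul`** ∕ `hGen_add`: the fibre map `hGen c` (typed `𝔸 →L[ℝ] 𝔸` in the Neumann module) is `ℂ`-LINEAR (it is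
  the two-sided inverse of the `ℂ`-linear corridor coefficient: `bijective_bcoef` + `bcoefL`).
* §5 THE JUNCTION SHAPE row S46 consumes, per coarse bond, AS MAPS: `hGenC c : 𝔸 →L[ℂ] 𝔸` (= `hGen c`),
  **`hopC c : 𝔸 →ₗ[ℂ] E`**, `hopC X = res (δ_{b₀(c)} (hGen c X))`, with **`apply_hopC`** `A (hopC X) = X` (S46's `hLQh`),
  **`norm_hopC_le`** `‖hopC X‖ ≤ (Lᵈ/L)/(1 − (Lᵈ/L)·24ε)·‖X‖` (S46's `hHop`, given that `res` does not increase the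
  norm of a one-bond field — true for the sup-norm restriction) and `hop_bound_nonneg` (S46's `hb`).
WHAT THIS DOES NOT DO.  The binder `HasFDerivAt Φ A 0` (`Φ v = Qtilde L 𝒯 V (ext v) c`) is S49's theorem (owner,
`ShellMeasureAverageAnalytic{,B7}`), NOT proved here; no real structure (row S47), no linearizing chart (row S46); (0.11)
untyped as before; nothing of Bałaban's estimates; NE7c NOT proved; 0/9 spine.
-/

noncomputable section

open Finset Function
open scoped Topology

namespace Summit.QuantumFields.BalabanUV.T4Continuum.ShellMeasureAverageDerivative

open Literature.MathematicalPhysics.QuantumFieldTheory.Balaban1983to89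
open Literature.MathematicalPhysics.QuantumLattice (ZdEdge)
open B7BlockGeometry (qppBonds)
open B13PkLocalTerms (hOp hOp_apply_b₀)
open B13CorridorSeparation (b0Z b0Z_injective b0Z_mem_qppBonds eq_of_b0Z_mem_qppBonds)
open B12HOperator267 (IsQppLocal bcoef)
open B12HOperatorNeumann267 (bijective_bcoef KMain KMain_apply)
open B12AverageCorridor267

variable {d : ℕ}

/-! ## §1 The line derivative of a Fréchet-differentiable map is the Fréchet derivative on the direction -/

section Line

variable {E F : Type*} [NormedAddCommGroup E] [NormedSpace ℂ E] [NormedAddCommGroup F] [NormedSpace ℂ F]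

/-- chain rule along the line `s ↦ s • v`: `d/ds|₀ Φ(s•v) = A v` for `HasFDerivAt Φ A 0`. [folklore] -/
theorem hasDerivAt_line_of_hasFDerivAt {Φ : E → F} {A : E →L[ℂ] F} (hΦ : HasFDerivAt Φ A 0) (v : E) :
    HasDerivAt (fun s : ℂ => Φ (s • v)) (A v) 0 := by
  have hl : HasDerivAt (fun s : ℂ => s • v) ((1 : ℂ) • v) 0 := (hasDerivAt_id (0 : ℂ)).smul_const v
  rw [one_smul] at hl
  have h := hΦ.comp_hasDerivAt_of_eq (0 : ℂ) hl (by rw [zero_smul])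
  exact h

/-- … hence `deriv (s ↦ Φ(s•v)) 0 = A v`. [folklore] -/
theorem deriv_line_eq {Φ : E → F} {A : E →L[ℂ] F} (hΦ : HasFDerivAt Φ A 0) (v : E) :
    deriv (fun s : ℂ => Φ (s • v)) 0 = A v :=
  (hasDerivAt_line_of_hasFDerivAt hΦ v).deriv

end Line

/-! ## §2 «LQ̃» IS the Fréchet derivative of the chart average; additivity and homogeneity -/

section LQ

variable {𝔸 : Type*} [NormedRing 𝔸] [NormedAlgebra ℂ 𝔸] [CompleteSpace 𝔸]
variable {L : ℕ} {𝒯 : (ZdEdge d → 𝔸ˣ) → (Fin d → ℤ) → 𝔸ˣ}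
variable {E : Type*} [NormedAddCommGroup E] [NormedSpace ℂ E]

/-- **THE `deriv`-TYPED «LQ̃» IS `DQ̃(0)` ON THE RANGE OF THE CHART**: if the chart average
`v ↦ Q̃_V(ext v)(c)` has Fréchet derivative `A` at `0` then `LQ L 𝒯 V (ext v) c = A v` for every direction `v`
(`LQ` unfolds to `deriv (s ↦ Q̃_V(s • ext v)(c)) 0` and `s • ext v = ext (s • v)`). [folklore] -/
theorem LQ_ext_eq (ext : E → (ZdEdge d → 𝔸)) (hext : ∀ (s : ℂ) (v : E), ext (s • v) = s • ext v)
    (V : ZdEdge d → 𝔸ˣ) (c : ZdEdge d) {Φ : E → 𝔸} (hΦ : ∀ v, Φ v = Qtilde L 𝒯 V (ext v) c)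
    {A : E →L[ℂ] 𝔸} (hF : HasFDerivAt Φ A 0) (v : E) : LQ L 𝒯 V (ext v) c = A v := by
  unfold LQ
  have e : (fun s : ℂ => Qtilde L 𝒯 V (s • ext v) c) = fun s : ℂ => Φ (s • v) := by
    funext s; rw [hΦ, hext]
  rw [e]
  exact deriv_line_eq hF v

/-- locality of «LQ̃» (`isQppLocal_LQ`): configurations agreeing on `qppBonds L c` have the same `LQ̃(·)(c)`.
[folklore] -/
theorem LQ_congr (hL : 0 < L) (h𝒯 : IsBlockLocal L 𝒯) (V : ZdEdge d → 𝔸ˣ) {B' B'' : ZdEdge d → 𝔸}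
    {c : ZdEdge d} (h : ∀ b ∈ qppBonds L c, B' b = B'' b) : LQ L 𝒯 V B' c = LQ L 𝒯 V B'' c :=
  isQppLocal_LQ hL h𝒯 V B' B'' c h

variable (ext : E → (ZdEdge d → 𝔸)) (res : (ZdEdge d → 𝔸) → E)

/-- **«LQ̃» ON EVERY CONFIGURATION THROUGH THE CHART**: with a `ℂ`-linear restriction `res` such that `ext (res B′)`
agrees with `B′` on `qppBonds L c`, `LQ L 𝒯 V B′ c = A (res B′)` for EVERY `B′`. [folklore] -/
theorem LQ_eq_apply_res (hext : ∀ (s : ℂ) (v : E), ext (s • v) = s • ext v) (hL : 0 < L)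
    (h𝒯 : IsBlockLocal L 𝒯) (V : ZdEdge d → 𝔸ˣ) (c : ZdEdge d)
    (hres : ∀ (B' : ZdEdge d → 𝔸), ∀ b ∈ qppBonds L c, ext (res B') b = B' b) {Φ : E → 𝔸}
    (hΦ : ∀ v, Φ v = Qtilde L 𝒯 V (ext v) c) {A : E →L[ℂ] 𝔸} (hF : HasFDerivAt Φ A 0) (B' : ZdEdge d → 𝔸) :
    LQ L 𝒯 V B' c = A (res B') := by
  rw [← LQ_ext_eq ext hext V c hΦ hF (res B')]
  exact LQ_congr hL h𝒯 V fun b hb => (hres B' b hb).symm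

/-- **«LQ̃» IS ADDITIVE** at `c` (typing (c) of `B12AverageCorridor267`, conditionally on the derivative binder).
[folklore] -/
theorem LQ_add (hext : ∀ (s : ℂ) (v : E), ext (s • v) = s • ext v)
    (hres_add : ∀ B₁ B₂ : ZdEdge d → 𝔸, res (B₁ + B₂) = res B₁ + res B₂) (hL : 0 < L) (h𝒯 : IsBlockLocal L 𝒯)
    (V : ZdEdge d → 𝔸ˣ) (c : ZdEdge d) (hres : ∀ (B' : ZdEdge d → 𝔸), ∀ b ∈ qppBonds L c, ext (res B') b = B' b)
    {Φ : E → 𝔸} (hΦ : ∀ v, Φ v = Qtilde L 𝒯 V (ext v) c) {A : E →L[ℂ] 𝔸} (hF : HasFDerivAt Φ A 0)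
    (B₁ B₂ : ZdEdge d → 𝔸) : LQ L 𝒯 V (B₁ + B₂) c = LQ L 𝒯 V B₁ c + LQ L 𝒯 V B₂ c := by
  rw [LQ_eq_apply_res ext res hext hL h𝒯 V c hres hΦ hF, LQ_eq_apply_res ext res hext hL h𝒯 V c hres hΦ hF,
    LQ_eq_apply_res ext res hext hL h𝒯 V c hres hΦ hF, hres_add, map_add]

/-- **«LQ̃» IS `ℂ`-HOMOGENEOUS** at `c`. [folklore] -/
theorem LQ_smul (hext : ∀ (s : ℂ) (v : E), ext (s • v) = s • ext v)
    (hres_smul : ∀ (a : ℂ) (B : ZdEdge d → 𝔸), res (a • B) = a • res B) (hL : 0 < L) (h𝒯 : IsBlockLocal L 𝒯)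
    (V : ZdEdge d → 𝔸ˣ) (c : ZdEdge d) (hres : ∀ (B' : ZdEdge d → 𝔸), ∀ b ∈ qppBonds L c, ext (res B') b = B' b)
    {Φ : E → 𝔸} (hΦ : ∀ v, Φ v = Qtilde L 𝒯 V (ext v) c) {A : E →L[ℂ] 𝔸} (hF : HasFDerivAt Φ A 0)
    (a : ℂ) (B' : ZdEdge d → 𝔸) : LQ L 𝒯 V (a • B') c = a • LQ L 𝒯 V B' c := by
  rw [LQ_eq_apply_res ext res hext hL h𝒯 V c hres hΦ hF, LQ_eq_apply_res ext res hext hL h𝒯 V c hres hΦ hF,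
    hres_smul, map_smul]

/-- `LQ̃(−B′)(c) = −LQ̃(B′)(c)`. [folklore] -/
theorem LQ_neg (hext : ∀ (s : ℂ) (v : E), ext (s • v) = s • ext v)
    (hres_smul : ∀ (a : ℂ) (B : ZdEdge d → 𝔸), res (a • B) = a • res B) (hL : 0 < L) (h𝒯 : IsBlockLocal L 𝒯)
    (V : ZdEdge d → 𝔸ˣ) (c : ZdEdge d) (hres : ∀ (B' : ZdEdge d → 𝔸), ∀ b ∈ qppBonds L c, ext (res B') b = B' b)
    {Φ : E → 𝔸} (hΦ : ∀ v, Φ v = Qtilde L 𝒯 V (ext v) c) {A : E →L[ℂ] 𝔸} (hF : HasFDerivAt Φ A 0)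
    (B' : ZdEdge d → 𝔸) : LQ L 𝒯 V (-B') c = -LQ L 𝒯 V B' c := by
  rw [← neg_one_smul ℂ B', LQ_smul ext res hext hres_smul hL h𝒯 V c hres hΦ hF, neg_one_smul]

/-- `LQ̃(B₁ − B₂)(c) = LQ̃(B₁)(c) − LQ̃(B₂)(c)`. [folklore] -/
theorem LQ_sub (hext : ∀ (s : ℂ) (v : E), ext (s • v) = s • ext v)
    (hres_add : ∀ B₁ B₂ : ZdEdge d → 𝔸, res (B₁ + B₂) = res B₁ + res B₂)
    (hres_smul : ∀ (a : ℂ) (B : ZdEdge d → 𝔸), res (a • B) = a • res B) (hL : 0 < L) (h𝒯 : IsBlockLocal L 𝒯)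
    (V : ZdEdge d → 𝔸ˣ) (c : ZdEdge d) (hres : ∀ (B' : ZdEdge d → 𝔸), ∀ b ∈ qppBonds L c, ext (res B') b = B' b)
    {Φ : E → 𝔸} (hΦ : ∀ v, Φ v = Qtilde L 𝒯 V (ext v) c) {A : E →L[ℂ] 𝔸} (hF : HasFDerivAt Φ A 0)
    (B₁ B₂ : ZdEdge d → 𝔸) : LQ L 𝒯 V (B₁ - B₂) c = LQ L 𝒯 V B₁ c - LQ L 𝒯 V B₂ c := by
  rw [sub_eq_add_neg, LQ_add ext res hext hres_add hL h𝒯 V c hres hΦ hF,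
    LQ_neg ext res hext hres_smul hL h𝒯 V c hres hΦ hF, ← sub_eq_add_neg]

/-! ## §3 The corridor coefficient is the Fréchet derivative on the corridor direction -/

/-- `bcoef L (LQ̃_V) c X = A (res (δ_{b₀(c)} X))`: the corridor coefficient of `B12HOperator267` read through the
Fréchet derivative. [folklore] -/
theorem bcoef_LQ_eq_apply_res (hext : ∀ (s : ℂ) (v : E), ext (s • v) = s • ext v) (hL : 0 < L)
    (h𝒯 : IsBlockLocal L 𝒯) (V : ZdEdge d → 𝔸ˣ) (c : ZdEdge d)
    (hres : ∀ (B' : ZdEdge d → 𝔸), ∀ b ∈ qppBonds L c, ext (res B') b = B' b) {Φ : E → 𝔸}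
    (hΦ : ∀ v, Φ v = Qtilde L 𝒯 V (ext v) c) {A : E →L[ℂ] 𝔸} (hF : HasFDerivAt Φ A 0) (X : 𝔸) :
    bcoef L (LQ L 𝒯 V) c X = A (res (Pi.single (b0Z L c) X)) := by
  unfold B12HOperator267.bcoef
  exact LQ_eq_apply_res ext res hext hL h𝒯 V c hres hΦ hF _

variable [NormOneClass 𝔸]

/-- **THE FRÉCHET DERIVATIVE ON THE CORRIDOR DIRECTION IS THE CLOSED FORM `bcoefVal`** of
`B12AverageCorridor267.hasDerivAt_Qtilde_single` (block-local, axis-straight `𝒯`; `‖W_x(V) − 1‖ < 1` off-axis).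
[folklore] -/
theorem apply_res_single_eq_bcoefVal (hext : ∀ (s : ℂ) (v : E), ext (s • v) = s • ext v) (hL : 0 < L)
    (h𝒯 : IsBlockLocal L 𝒯) (h𝒯' : IsAxisStraightFamily L 𝒯) (V : ZdEdge d → 𝔸ˣ) (c : ZdEdge d)
    (hres : ∀ (B' : ZdEdge d → 𝔸), ∀ b ∈ qppBonds L c, ext (res B') b = B' b) {Φ : E → 𝔸}
    (hΦ : ∀ v, Φ v = Qtilde L 𝒯 V (ext v) c) {A : E →L[ℂ] 𝔸} (hF : HasFDerivAt Φ A 0)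
    (hW : ∀ x ∈ offAxis L c, ‖((loopW L 𝒯 V c x : 𝔸ˣ) : 𝔸) - 1‖ < 1) (X : 𝔸) :
    A (res (Pi.single (b0Z L c) X)) = bcoefVal L 𝒯 V c X := by
  rw [← bcoef_LQ_eq_apply_res ext res hext hL h𝒯 V c hres hΦ hF, bcoef_LQ hL h𝒯 h𝒯' V c X hW]

/-! ## §4 p. 267's `h` is a right inverse of the Fréchet derivative; `ℂ`-linearity of the fibre map; the S46 shape -/

section Paragraph

/-- the corridor coefficient inverts the fibre map: `bcoef L (LQ̃_V) c (hGen c X) = X` — clause (i) «LQ̃h = I» of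
`h_paragraph_p267_genuine` read fibrewise (`IsQppLocal.hOp_rightInverse_iff`). [folklore] -/
theorem bcoef_hGen (hL : 0 < L) (h𝒯 : IsBlockLocal L 𝒯) (h𝒯' : IsAxisStraightFamily L 𝒯)
    (V : ZdEdge d → 𝔸ˣ) {ε : ℝ} (hε0 : 0 ≤ ε) (hε : ε ≤ 1 / 8)
    (hW : ∀ c, ∀ x ∈ offAxis L c, ‖((loopW L 𝒯 V c x : 𝔸ˣ) : 𝔸) - 1‖ ≤ ε)
    (hV : ∀ b, ‖((V b : 𝔸ˣ) : 𝔸)‖ ≤ 1) (hV' : ∀ b, ‖(((V b)⁻¹ : 𝔸ˣ) : 𝔸)‖ ≤ 1)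
    (hbud : (L : ℝ) ^ d / L * (24 * ε) < 1)
    (c : ZdEdge d) (X : 𝔸) : bcoef L (LQ L 𝒯 V) c (hGen hL h𝒯' V hε0 hε hW hV hV' hbud c X) = X :=
  ((isQppLocal_LQ hL h𝒯 V).hOp_rightInverse_iff hL _).1
    (h_paragraph_p267_genuine hL h𝒯 h𝒯' V hε0 hε hW hV hV' hbud).1 c X

/-- the corridor coefficient of `LQ̃_V` is one-to-one (small field): `bijective_bcoef` of the Neumann module with
`hK := bcoef_LQ_eq_coef_sub`, `hq := relPert_lt_one`. [folklore] -/
theorem bcoef_injective (hL : 0 < L) (h𝒯 : IsBlockLocal L 𝒯) (h𝒯' : IsAxisStraightFamily L 𝒯)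
    (V : ZdEdge d → 𝔸ˣ) {ε : ℝ} (hε0 : 0 ≤ ε) (hε : ε ≤ 1 / 8)
    (hW : ∀ c, ∀ x ∈ offAxis L c, ‖((loopW L 𝒯 V c x : 𝔸ˣ) : 𝔸) - 1‖ ≤ ε)
    (hV : ∀ b, ‖((V b : 𝔸ˣ) : 𝔸)‖ ≤ 1) (hV' : ∀ b, ‖(((V b)⁻¹ : 𝔸ˣ) : 𝔸)‖ ≤ 1)
    (hbud : (L : ℝ) ^ d / L * (24 * ε) < 1) (c : ZdEdge d) : Function.Injective (bcoef L (LQ L 𝒯 V) c) :=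
  (bijective_bcoef (𝒬 := LQ L 𝒯 V)
    (K := KMain (axisStraight_conj h𝒯' V) hL (norm_Rconj_le hV) (norm_Rconj_inv_le hV')) (S := Scorr L 𝒯 V)
    (fun c X => by
      rw [KMain_apply]
      exact bcoef_LQ_eq_coef_sub hL h𝒯 h𝒯' V c X fun x hx => (hW c x hx).trans_lt (by linarith))
    (relPert_lt_one hL h𝒯' V hε0 hε hW hV hV' hbud) c).1

/-- the corridor coefficient of `LQ̃_V` is `ℂ`-homogeneous (it is the `ℂ`-linear map `bcoefL` — `bcoef_LQ`,
`bcoefL_apply`; loop small field `‖W_x(V) − 1‖ < 1` off-axis). [folklore] -/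
theorem bcoef_LQ_smul (hL : 0 < L) (h𝒯 : IsBlockLocal L 𝒯) (h𝒯' : IsAxisStraightFamily L 𝒯)
    (V : ZdEdge d → 𝔸ˣ) (c : ZdEdge d) (hW1 : ∀ x ∈ offAxis L c, ‖((loopW L 𝒯 V c x : 𝔸ˣ) : 𝔸) - 1‖ < 1)
    (a : ℂ) (X : 𝔸) : bcoef L (LQ L 𝒯 V) c (a • X) = a • bcoef L (LQ L 𝒯 V) c X := by
  rw [bcoef_LQ hL h𝒯 h𝒯' V c (a • X) hW1, bcoef_LQ hL h𝒯 h𝒯' V c X hW1, ← bcoefL_apply, ← bcoefL_apply, map_smul]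

/-- the corridor coefficient of `LQ̃_V` is additive. [folklore] -/
theorem bcoef_LQ_add (hL : 0 < L) (h𝒯 : IsBlockLocal L 𝒯) (h𝒯' : IsAxisStraightFamily L 𝒯)
    (V : ZdEdge d → 𝔸ˣ) (c : ZdEdge d) (hW1 : ∀ x ∈ offAxis L c, ‖((loopW L 𝒯 V c x : 𝔸ˣ) : 𝔸) - 1‖ < 1)
    (X Y : 𝔸) : bcoef L (LQ L 𝒯 V) c (X + Y) = bcoef L (LQ L 𝒯 V) c X + bcoef L (LQ L 𝒯 V) c Y := by
  rw [bcoef_LQ hL h𝒯 h𝒯' V c (X + Y) hW1, bcoef_LQ hL h𝒯 h𝒯' V c X hW1, bcoef_LQ hL h𝒯 h𝒯' V c Y hW1,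
    ← bcoefL_apply, ← bcoefL_apply, ← bcoefL_apply, map_add]

/-- **THE FIBRE MAP `hGen c` IS `ℂ`-HOMOGENEOUS** (typed `𝔸 →L[ℝ] 𝔸` in `B12HOperatorNeumann267`; it is the inverse of
the `ℂ`-linear bijection `bcoef L (LQ̃_V) c`). [folklore] -/
theorem hGen_smul (hL : 0 < L) (h𝒯 : IsBlockLocal L 𝒯) (h𝒯' : IsAxisStraightFamily L 𝒯)
    (V : ZdEdge d → 𝔸ˣ) {ε : ℝ} (hε0 : 0 ≤ ε) (hε : ε ≤ 1 / 8)
    (hW : ∀ c, ∀ x ∈ offAxis L c, ‖((loopW L 𝒯 V c x : 𝔸ˣ) : 𝔸) - 1‖ ≤ ε)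
    (hV : ∀ b, ‖((V b : 𝔸ˣ) : 𝔸)‖ ≤ 1) (hV' : ∀ b, ‖(((V b)⁻¹ : 𝔸ˣ) : 𝔸)‖ ≤ 1)
    (hbud : (L : ℝ) ^ d / L * (24 * ε) < 1)
    (c : ZdEdge d) (a : ℂ) (X : 𝔸) :
    hGen hL h𝒯' V hε0 hε hW hV hV' hbud c (a • X) = a • hGen hL h𝒯' V hε0 hε hW hV hV' hbud c X := by
  have hW1 : ∀ x ∈ offAxis L c, ‖((loopW L 𝒯 V c x : 𝔸ˣ) : 𝔸) - 1‖ < 1 :=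
    fun x hx => (hW c x hx).trans_lt (by linarith)
  apply bcoef_injective hL h𝒯 h𝒯' V hε0 hε hW hV hV' hbud c
  rw [bcoef_hGen hL h𝒯 h𝒯' V hε0 hε hW hV hV' hbud, bcoef_LQ_smul hL h𝒯 h𝒯' V c hW1,
    bcoef_hGen hL h𝒯 h𝒯' V hε0 hε hW hV hV' hbud]

/-- the fibre map `hGen c` is additive (it is a continuous `ℝ`-linear map). [folklore] -/
theorem hGen_add (hL : 0 < L) (h𝒯' : IsAxisStraightFamily L 𝒯)
    (V : ZdEdge d → 𝔸ˣ) {ε : ℝ} (hε0 : 0 ≤ ε) (hε : ε ≤ 1 / 8)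
    (hW : ∀ c, ∀ x ∈ offAxis L c, ‖((loopW L 𝒯 V c x : 𝔸ˣ) : 𝔸) - 1‖ ≤ ε)
    (hV : ∀ b, ‖((V b : 𝔸ˣ) : 𝔸)‖ ≤ 1) (hV' : ∀ b, ‖(((V b)⁻¹ : 𝔸ˣ) : 𝔸)‖ ≤ 1)
    (hbud : (L : ℝ) ^ d / L * (24 * ε) < 1) (c : ZdEdge d) (X Y : 𝔸) :
    hGen hL h𝒯' V hε0 hε hW hV hV' hbud c (X + Y) =
      hGen hL h𝒯' V hε0 hε hW hV hV' hbud c X + hGen hL h𝒯' V hε0 hε hW hV hV' hbud c Y :=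
  map_add _ X Y

/-- **«LQ̃h = I» READ THROUGH THE FRÉCHET DERIVATIVE**: for every coarse field `B` and coarse bond `c`,
`A (res (hOp b₀ hGen B)) = B c` — p. 267's corridor-supported `h` is a right inverse of `DQ̃(0)` composed with the
evaluation at `c`. [folklore] -/
theorem apply_res_hOp_eq (hext : ∀ (s : ℂ) (v : E), ext (s • v) = s • ext v)
    (hL : 0 < L) (h𝒯 : IsBlockLocal L 𝒯) (h𝒯' : IsAxisStraightFamily L 𝒯)
    (V : ZdEdge d → 𝔸ˣ) {ε : ℝ} (hε0 : 0 ≤ ε) (hε : ε ≤ 1 / 8)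
    (hW : ∀ c, ∀ x ∈ offAxis L c, ‖((loopW L 𝒯 V c x : 𝔸ˣ) : 𝔸) - 1‖ ≤ ε)
    (hV : ∀ b, ‖((V b : 𝔸ˣ) : 𝔸)‖ ≤ 1) (hV' : ∀ b, ‖(((V b)⁻¹ : 𝔸ˣ) : 𝔸)‖ ≤ 1)
    (hbud : (L : ℝ) ^ d / L * (24 * ε) < 1)
    (c : ZdEdge d) (hres : ∀ (B' : ZdEdge d → 𝔸), ∀ b ∈ qppBonds L c, ext (res B') b = B' b) {Φ : E → 𝔸}
    (hΦ : ∀ v, Φ v = Qtilde L 𝒯 V (ext v) c) {A : E →L[ℂ] 𝔸} (hF : HasFDerivAt Φ A 0) (B : ZdEdge d → 𝔸) :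
    A (res (hOp (b0Z L) (fun c X => hGen hL h𝒯' V hε0 hε hW hV hV' hbud c X) B)) = B c := by
  rw [← LQ_eq_apply_res ext res hext hL h𝒯 V c hres hΦ hF]
  exact (h_paragraph_p267_genuine hL h𝒯 h𝒯' V hε0 hε hW hV hV' hbud).1 B c

/-- the one-bond form: `A (res (δ_{b₀(c)} (hGen c X))) = X`. [folklore] -/
theorem apply_res_single_hGen (hext : ∀ (s : ℂ) (v : E), ext (s • v) = s • ext v)
    (hL : 0 < L) (h𝒯 : IsBlockLocal L 𝒯) (h𝒯' : IsAxisStraightFamily L 𝒯)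
    (V : ZdEdge d → 𝔸ˣ) {ε : ℝ} (hε0 : 0 ≤ ε) (hε : ε ≤ 1 / 8)
    (hW : ∀ c, ∀ x ∈ offAxis L c, ‖((loopW L 𝒯 V c x : 𝔸ˣ) : 𝔸) - 1‖ ≤ ε)
    (hV : ∀ b, ‖((V b : 𝔸ˣ) : 𝔸)‖ ≤ 1) (hV' : ∀ b, ‖(((V b)⁻¹ : 𝔸ˣ) : 𝔸)‖ ≤ 1)
    (hbud : (L : ℝ) ^ d / L * (24 * ε) < 1)
    (c : ZdEdge d) (hres : ∀ (B' : ZdEdge d → 𝔸), ∀ b ∈ qppBonds L c, ext (res B') b = B' b) {Φ : E → 𝔸}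
    (hΦ : ∀ v, Φ v = Qtilde L 𝒯 V (ext v) c) {A : E →L[ℂ] 𝔸} (hF : HasFDerivAt Φ A 0) (X : 𝔸) :
    A (res (Pi.single (b0Z L c) (hGen hL h𝒯' V hε0 hε hW hV hV' hbud c X))) = X := by
  rw [← bcoef_LQ_eq_apply_res ext res hext hL h𝒯 V c hres hΦ hF]
  exact bcoef_hGen hL h𝒯 h𝒯' V hε0 hε hW hV hV' hbud c X

/-! ## §5 Packaged: the `ℂ`-linear fibre map and the S46 `hop` per coarse bond, as maps -/

/-- p. 267's fibre map `h(c)` AS A CONTINUOUS `ℂ`-LINEAR MAP (the Neumann module types it over `ℝ`; `hGen_smul`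
upgrades it). [folklore] -/
def hGenC (hL : 0 < L) (h𝒯 : IsBlockLocal L 𝒯) (h𝒯' : IsAxisStraightFamily L 𝒯)
    (V : ZdEdge d → 𝔸ˣ) {ε : ℝ} (hε0 : 0 ≤ ε) (hε : ε ≤ 1 / 8)
    (hW : ∀ c, ∀ x ∈ offAxis L c, ‖((loopW L 𝒯 V c x : 𝔸ˣ) : 𝔸) - 1‖ ≤ ε)
    (hV : ∀ b, ‖((V b : 𝔸ˣ) : 𝔸)‖ ≤ 1) (hV' : ∀ b, ‖(((V b)⁻¹ : 𝔸ˣ) : 𝔸)‖ ≤ 1)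
    (hbud : (L : ℝ) ^ d / L * (24 * ε) < 1)
    (c : ZdEdge d) : 𝔸 →L[ℂ] 𝔸 :=
  { toFun := fun X => hGen hL h𝒯' V hε0 hε hW hV hV' hbud c X,
    map_add' := fun X Y => hGen_add hL h𝒯' V hε0 hε hW hV hV' hbud c X Y,
    map_smul' := fun a X => hGen_smul hL h𝒯 h𝒯' V hε0 hε hW hV hV' hbud c a X,
    cont := (hGen hL h𝒯' V hε0 hε hW hV hV' hbud c).continuous }

/-- unfolding: `hGenC c X = hGen c X`. [folklore] -/
@[simp] theorem hGenC_apply (hL : 0 < L) (h𝒯 : IsBlockLocal L 𝒯) (h𝒯' : IsAxisStraightFamily L 𝒯)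
    (V : ZdEdge d → 𝔸ˣ) {ε : ℝ} (hε0 : 0 ≤ ε) (hε : ε ≤ 1 / 8)
    (hW : ∀ c, ∀ x ∈ offAxis L c, ‖((loopW L 𝒯 V c x : 𝔸ˣ) : 𝔸) - 1‖ ≤ ε)
    (hV : ∀ b, ‖((V b : 𝔸ˣ) : 𝔸)‖ ≤ 1) (hV' : ∀ b, ‖(((V b)⁻¹ : 𝔸ˣ) : 𝔸)‖ ≤ 1)
    (hbud : (L : ℝ) ^ d / L * (24 * ε) < 1)
    (c : ZdEdge d) (X : 𝔸) :
    hGenC hL h𝒯 h𝒯' V hε0 hε hW hV hV' hbud c X = hGen hL h𝒯' V hε0 hε hW hV hV' hbud c X := rfl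

/-- THE S46 `hop` PER COARSE BOND AS A `ℂ`-LINEAR MAP: `X ↦ res (δ_{b₀(c)} (h(c) X))` — the corridor-supported
field of p. 267 («(hB)(b₀(c)) = h(c)B(c)», zero elsewhere) seen in the chart `E` of the fine fields near `c` (`res`
additive and `ℂ`-homogeneous). [folklore] -/
def hopC (hres_add : ∀ B₁ B₂ : ZdEdge d → 𝔸, res (B₁ + B₂) = res B₁ + res B₂)
    (hres_smul : ∀ (a : ℂ) (B : ZdEdge d → 𝔸), res (a • B) = a • res B)
    (hL : 0 < L) (h𝒯 : IsBlockLocal L 𝒯) (h𝒯' : IsAxisStraightFamily L 𝒯)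
    (V : ZdEdge d → 𝔸ˣ) {ε : ℝ} (hε0 : 0 ≤ ε) (hε : ε ≤ 1 / 8)
    (hW : ∀ c, ∀ x ∈ offAxis L c, ‖((loopW L 𝒯 V c x : 𝔸ˣ) : 𝔸) - 1‖ ≤ ε)
    (hV : ∀ b, ‖((V b : 𝔸ˣ) : 𝔸)‖ ≤ 1) (hV' : ∀ b, ‖(((V b)⁻¹ : 𝔸ˣ) : 𝔸)‖ ≤ 1)
    (hbud : (L : ℝ) ^ d / L * (24 * ε) < 1)
    (c : ZdEdge d) : 𝔸 →ₗ[ℂ] E where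
  toFun X := res (Pi.single (b0Z L c) (hGen hL h𝒯' V hε0 hε hW hV hV' hbud c X))
  map_add' X Y := by
    show res _ = res _ + res _
    rw [hGen_add hL h𝒯' V hε0 hε hW hV hV' hbud, Pi.single_add, hres_add]
  map_smul' a X := by
    show res _ = a • res _
    rw [hGen_smul hL h𝒯 h𝒯' V hε0 hε hW hV hV' hbud, Pi.single_smul, hres_smul]

/-- unfolding: `hopC c X = res (δ_{b₀(c)} (hGen c X))`. [folklore] -/
theorem hopC_apply (hres_add : ∀ B₁ B₂ : ZdEdge d → 𝔸, res (B₁ + B₂) = res B₁ + res B₂)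
    (hres_smul : ∀ (a : ℂ) (B : ZdEdge d → 𝔸), res (a • B) = a • res B)
    (hL : 0 < L) (h𝒯 : IsBlockLocal L 𝒯) (h𝒯' : IsAxisStraightFamily L 𝒯)
    (V : ZdEdge d → 𝔸ˣ) {ε : ℝ} (hε0 : 0 ≤ ε) (hε : ε ≤ 1 / 8)
    (hW : ∀ c, ∀ x ∈ offAxis L c, ‖((loopW L 𝒯 V c x : 𝔸ˣ) : 𝔸) - 1‖ ≤ ε)
    (hV : ∀ b, ‖((V b : 𝔸ˣ) : 𝔸)‖ ≤ 1) (hV' : ∀ b, ‖(((V b)⁻¹ : 𝔸ˣ) : 𝔸)‖ ≤ 1)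
    (hbud : (L : ℝ) ^ d / L * (24 * ε) < 1)
    (c : ZdEdge d) (X : 𝔸) :
    hopC res hres_add hres_smul hL h𝒯 h𝒯' V hε0 hε hW hV hV' hbud c X =
      res (Pi.single (b0Z L c) (hGen hL h𝒯' V hε0 hε hW hV hV' hbud c X)) := rfl

/-- **S46's `hLQh` for the map form**: `A (hopC c X) = X` for the Fréchet derivative `A` of the chart average at `0`.
[folklore] -/
theorem apply_hopC (hext : ∀ (s : ℂ) (v : E), ext (s • v) = s • ext v)
    (hres_add : ∀ B₁ B₂ : ZdEdge d → 𝔸, res (B₁ + B₂) = res B₁ + res B₂)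
    (hres_smul : ∀ (a : ℂ) (B : ZdEdge d → 𝔸), res (a • B) = a • res B)
    (hL : 0 < L) (h𝒯 : IsBlockLocal L 𝒯) (h𝒯' : IsAxisStraightFamily L 𝒯)
    (V : ZdEdge d → 𝔸ˣ) {ε : ℝ} (hε0 : 0 ≤ ε) (hε : ε ≤ 1 / 8)
    (hW : ∀ c, ∀ x ∈ offAxis L c, ‖((loopW L 𝒯 V c x : 𝔸ˣ) : 𝔸) - 1‖ ≤ ε)
    (hV : ∀ b, ‖((V b : 𝔸ˣ) : 𝔸)‖ ≤ 1) (hV' : ∀ b, ‖(((V b)⁻¹ : 𝔸ˣ) : 𝔸)‖ ≤ 1)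
    (hbud : (L : ℝ) ^ d / L * (24 * ε) < 1)
    (c : ZdEdge d) (hres : ∀ (B' : ZdEdge d → 𝔸), ∀ b ∈ qppBonds L c, ext (res B') b = B' b) {Φ : E → 𝔸}
    (hΦ : ∀ v, Φ v = Qtilde L 𝒯 V (ext v) c) {A : E →L[ℂ] 𝔸} (hF : HasFDerivAt Φ A 0) (X : 𝔸) :
    A (hopC res hres_add hres_smul hL h𝒯 h𝒯' V hε0 hε hW hV hV' hbud c X) = X := by
  rw [hopC_apply]
  exact apply_res_single_hGen ext res hext hL h𝒯 h𝒯' V hε0 hε hW hV hV' hbud c hres hΦ hF X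

/-- **S46's `hHop` for the map form**: `‖hopC c X‖ ≤ (Lᵈ/L)/(1 − (Lᵈ/L)·24ε)·‖X‖` when the restriction does not
increase the norm of a one-bond field. [folklore] -/
theorem norm_hopC_le (hres_add : ∀ B₁ B₂ : ZdEdge d → 𝔸, res (B₁ + B₂) = res B₁ + res B₂)
    (hres_smul : ∀ (a : ℂ) (B : ZdEdge d → 𝔸), res (a • B) = a • res B)
    (hL : 0 < L) (h𝒯 : IsBlockLocal L 𝒯) (h𝒯' : IsAxisStraightFamily L 𝒯)
    (V : ZdEdge d → 𝔸ˣ) {ε : ℝ} (hε0 : 0 ≤ ε) (hε : ε ≤ 1 / 8)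
    (hW : ∀ c, ∀ x ∈ offAxis L c, ‖((loopW L 𝒯 V c x : 𝔸ˣ) : 𝔸) - 1‖ ≤ ε)
    (hV : ∀ b, ‖((V b : 𝔸ˣ) : 𝔸)‖ ≤ 1) (hV' : ∀ b, ‖(((V b)⁻¹ : 𝔸ˣ) : 𝔸)‖ ≤ 1)
    (hbud : (L : ℝ) ^ d / L * (24 * ε) < 1)
    (c : ZdEdge d) (hresn : ∀ Y : 𝔸, ‖res (Pi.single (b0Z L c) Y)‖ ≤ ‖Y‖) (X : 𝔸) :
    ‖hopC res hres_add hres_smul hL h𝒯 h𝒯' V hε0 hε hW hV hV' hbud c X‖ ≤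
      ((L : ℝ) ^ d / L) / (1 - (L : ℝ) ^ d / L * (24 * ε)) * ‖X‖ := by
  rw [hopC_apply]
  exact (hresn _).trans ((h_paragraph_p267_genuine hL h𝒯 h𝒯' V hε0 hε hW hV hV' hbud).2.2 c X)

/-- **S46's `hb`**: the bound constant is non-negative, `0 ≤ (Lᵈ/L)/(1 − (Lᵈ/L)·24ε)` (`0 < L`, the Neumann budget).
[folklore] -/
theorem hop_bound_nonneg (hL : 0 < L) {ε : ℝ} (hbud : (L : ℝ) ^ d / L * (24 * ε) < 1) :
    0 ≤ ((L : ℝ) ^ d / L) / (1 - (L : ℝ) ^ d / L * (24 * ε)) := by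
  have hLr : (0 : ℝ) < L := by exact_mod_cast hL
  exact div_nonneg (by positivity) (by linarith)

end Paragraph

end LQ

end Summit.QuantumFields.BalabanUV.T4Continuum.ShellMeasureAverageDerivative

end
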